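import Literature.MathematicalPhysics.QuantumLattice.SU2Haar

/-!
# `CovarianceBound` — negative-side support: the rotation angle on `SU(2)` and a Jensen step

Support file for crux `stmt-QuantumFields-8780` (`ConvexGribovBody.CovarianceBound`), extracted from the
standing disprover's work file `Cruxes/CovarianceBound/Disproof.lean` (§C, `toron_tight`). Tree objects
only; nothing is posited; axioms `propext`, `Classical.choice`, `Quot.sound`. Self-contained `SU(2)`
geometry used by `ToronMinimiser.lean` to CERTIFY an absolute minimiser of the slice Coulomb functional:

* `ang V = arccos (Re V₀₀) ∈ [0, π]` — the rotation half-angle (`Re tr V = 2 cos φ(V)`), i.e. the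
  bi-invariant geodesic distance from `1` on `SU(2) ≅ S³` (first-row data from the tree's `SU2Haar`:
  `su2_apply_10/11`, `normSq_su2Quat`);
* `cos_min_le_re_mul`, `ang_mul_le` — the triangle inequality `φ(VW) ≤ min π (φ V + φ W)` (Cauchy–Schwarz
  in `ℝ³` on the imaginary quaternion parts);
* `oprod`, `ang_oprod_le`, `pi_le_sum_ang` — along an ordered product, `φ(V₀⋯V_{k−1}) ≤ min π (Σ φ(V_i))`;
  if the product is `−1` the angles sum to `≥ π`;
* `sum_cos_le` — for `L ≥ 5` angles in `[0, π]` with sum `≥ π`, `Σ cos θ_i ≤ L cos(π/L)` (concavity of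
  `cos` on `[−π/2, π/2]` via Mathlib's Jensen, or one obtuse angle and `1 − x²/2 ≤ cos x`).
-/

set_option autoImplicit false

namespace Summit.QuantumFields.YangMills.Theorems.CovarianceBound.Negative

open scoped Matrix ComplexConjugate Real
open Literature.MathematicalPhysics.QuantumLattice

noncomputable section



/-- The rotation half-angle `φ(V) = arccos (Re V₀₀) ∈ [0, π]` of `V ∈ SU(2)` (`Re tr V = 2 cos φ(V)`):
the bi-invariant geodesic distance from `1` on `SU(2) ≅ S³`. -/
def ang (V : Matrix.specialUnitaryGroup (Fin 2) ℂ) : ℝ := Real.arccos ((V : Matrix (Fin 2) (Fin 2) ℂ) 0 0).re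

/-- First-row unit norm: `(Re V₀₀)² + (Im V₀₀)² + (Re V₀₁)² + (Im V₀₁)² = 1`. -/
theorem su2_row_normSq (V : Matrix.specialUnitaryGroup (Fin 2) ℂ) :
    ((V : Matrix (Fin 2) (Fin 2) ℂ) 0 0).re ^ 2 + ((V : Matrix (Fin 2) (Fin 2) ℂ) 0 0).im ^ 2 +
      ((V : Matrix (Fin 2) (Fin 2) ℂ) 0 1).re ^ 2 + ((V : Matrix (Fin 2) (Fin 2) ℂ) 0 1).im ^ 2 = 1 := by
  have h := normSq_su2Quat V
  simp only [su2Quat, Quaternion.normSq_def'] at h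
  linarith [h]

/-- `Re V₀₀ ≤ 1`. -/
theorem re_le_one (V : Matrix.specialUnitaryGroup (Fin 2) ℂ) : ((V : Matrix (Fin 2) (Fin 2) ℂ) 0 0).re ≤ 1 := by
  nlinarith [su2_row_normSq V, sq_nonneg (((V : Matrix (Fin 2) (Fin 2) ℂ) 0 0).re - 1)]

/-- `−1 ≤ Re V₀₀`. -/
theorem neg_one_le_re (V : Matrix.specialUnitaryGroup (Fin 2) ℂ) : -1 ≤ ((V : Matrix (Fin 2) (Fin 2) ℂ) 0 0).re := by
  nlinarith [su2_row_normSq V, sq_nonneg (((V : Matrix (Fin 2) (Fin 2) ℂ) 0 0).re + 1)]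

/-- `0 ≤ φ(V)`. -/
theorem ang_nonneg (V : Matrix.specialUnitaryGroup (Fin 2) ℂ) : 0 ≤ ang V := Real.arccos_nonneg _

/-- `φ(V) ≤ π`. -/
theorem ang_le_pi (V : Matrix.specialUnitaryGroup (Fin 2) ℂ) : ang V ≤ π := Real.arccos_le_pi _

/-- `cos φ(V) = Re V₀₀`. -/
theorem cos_ang (V : Matrix.specialUnitaryGroup (Fin 2) ℂ) :
    Real.cos (ang V) = ((V : Matrix (Fin 2) (Fin 2) ℂ) 0 0).re :=
  Real.cos_arccos (neg_one_le_re V) (re_le_one V)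

/-- `sin φ(V) = √(1 − (Re V₀₀)²)`. -/
theorem sin_ang (V : Matrix.specialUnitaryGroup (Fin 2) ℂ) :
    Real.sin (ang V) = Real.sqrt (1 - ((V : Matrix (Fin 2) (Fin 2) ℂ) 0 0).re ^ 2) :=
  Real.sin_arccos _

/-- The `(0,0)` entry of a product in `SU(2)`. -/
theorem mul_apply_zero_zero (V W : Matrix.specialUnitaryGroup (Fin 2) ℂ) :
    ((V * W : Matrix.specialUnitaryGroup (Fin 2) ℂ) : Matrix (Fin 2) (Fin 2) ℂ) 0 0 =
      (V : Matrix (Fin 2) (Fin 2) ℂ) 0 0 * (W : Matrix (Fin 2) (Fin 2) ℂ) 0 0 -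
        (V : Matrix (Fin 2) (Fin 2) ℂ) 0 1 * conj ((W : Matrix (Fin 2) (Fin 2) ℂ) 0 1) := by
  rw [show ((V * W : Matrix.specialUnitaryGroup (Fin 2) ℂ) : Matrix (Fin 2) (Fin 2) ℂ) =
      (V : Matrix (Fin 2) (Fin 2) ℂ) * W from rfl, Matrix.mul_apply, Fin.sum_univ_two, su2_apply_10]
  ring

/-- **Triangle inequality for the angle** in cosine form: `Re (VW)₀₀ ≥ cos (min π (φ V + φ W))`. -/
theorem cos_min_le_re_mul (V W : Matrix.specialUnitaryGroup (Fin 2) ℂ) :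
    Real.cos (min π (ang V + ang W)) ≤
      (((V * W : Matrix.specialUnitaryGroup (Fin 2) ℂ) : Matrix (Fin 2) (Fin 2) ℂ) 0 0).re := by
  by_cases hle : ang V + ang W ≤ π
  · rw [min_eq_right hle, Real.cos_add, cos_ang, cos_ang, sin_ang, sin_ang, mul_apply_zero_zero]
    set a := (V : Matrix (Fin 2) (Fin 2) ℂ) 0 0
    set b := (V : Matrix (Fin 2) (Fin 2) ℂ) 0 1
    set c := (W : Matrix (Fin 2) (Fin 2) ℂ) 0 0
    set d := (W : Matrix (Fin 2) (Fin 2) ℂ) 0 1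
    have hV : a.re ^ 2 + a.im ^ 2 + b.re ^ 2 + b.im ^ 2 = 1 := su2_row_normSq V
    have hW : c.re ^ 2 + c.im ^ 2 + d.re ^ 2 + d.im ^ 2 = 1 := su2_row_normSq W
    have hre : (a * c - b * conj d).re = a.re * c.re - (a.im * c.im + b.re * d.re + b.im * d.im) := by
      simp [Complex.mul_re, Complex.sub_re]; ring
    rw [hre]
    -- Cauchy–Schwarz in ℝ³
    have hp : 1 - a.re ^ 2 = a.im ^ 2 + b.re ^ 2 + b.im ^ 2 := by linarith
    have hq : 1 - c.re ^ 2 = c.im ^ 2 + d.re ^ 2 + d.im ^ 2 := by linarith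
    have hcs : (a.im * c.im + b.re * d.re + b.im * d.im) ^ 2 ≤
        (a.im ^ 2 + b.re ^ 2 + b.im ^ 2) * (c.im ^ 2 + d.re ^ 2 + d.im ^ 2) := by
      nlinarith [sq_nonneg (a.im * d.re - b.re * c.im), sq_nonneg (a.im * d.im - b.im * c.im),
        sq_nonneg (b.re * d.im - b.im * d.re)]
    have hsqrt : a.im * c.im + b.re * d.re + b.im * d.im ≤
        Real.sqrt (1 - a.re ^ 2) * Real.sqrt (1 - c.re ^ 2) := by
      rw [← Real.sqrt_mul (by rw [hp]; positivity), hp, hq]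
      exact Real.le_sqrt_of_sq_le hcs
    linarith
  · rw [min_eq_left (le_of_lt (not_le.mp hle)), Real.cos_pi]
    exact neg_one_le_re (V * W)

/-- The angle is subadditive up to the cap `π`: `φ(VW) ≤ min π (φ V + φ W)`. -/
theorem ang_mul_le (V W : Matrix.specialUnitaryGroup (Fin 2) ℂ) : ang (V * W) ≤ min π (ang V + ang W) := by
  have h := cos_min_le_re_mul V W
  have hmin0 : 0 ≤ min π (ang V + ang W) := le_min Real.pi_pos.le (add_nonneg (ang_nonneg V) (ang_nonneg W))
  have hminπ : min π (ang V + ang W) ≤ π := min_le_left _ _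
  calc ang (V * W)
      = Real.arccos (((V * W : Matrix.specialUnitaryGroup (Fin 2) ℂ) : Matrix (Fin 2) (Fin 2) ℂ) 0 0).re := rfl
    _ ≤ Real.arccos (Real.cos (min π (ang V + ang W))) := Real.antitone_arccos h
    _ = min π (ang V + ang W) := Real.arccos_cos hmin0 hminπ

/-- `φ(1) = 0`. -/
theorem ang_one : ang 1 = 0 := by
  simp [ang]

/-- Ordered product `V 0 * V 1 * ⋯ * V (k-1)`. -/
def oprod (V : ℕ → Matrix.specialUnitaryGroup (Fin 2) ℂ) : ℕ → Matrix.specialUnitaryGroup (Fin 2) ℂ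
  | 0 => 1
  | k + 1 => oprod V k * V k

/-- **Subadditivity along a chain**: `φ(V₀⋯V_{k-1}) ≤ min π (Σ_{i<k} φ(V_i))`. -/
theorem ang_oprod_le (V : ℕ → Matrix.specialUnitaryGroup (Fin 2) ℂ) (k : ℕ) :
    ang (oprod V k) ≤ min π (∑ i ∈ Finset.range k, ang (V i)) := by
  induction k with
  | zero => simp [oprod, ang_one, Real.pi_pos.le]
  | succ k ih =>
    rw [oprod, Finset.sum_range_succ]
    refine (ang_mul_le _ _).trans ?_
    refine le_min (min_le_left _ _) ?_
    calc min π (ang (oprod V k) + ang (V k)) ≤ ang (oprod V k) + ang (V k) := min_le_right _ _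
      _ ≤ _ := by
        have hk := ang_nonneg (V k)
        rcases le_total π (∑ i ∈ Finset.range k, ang (V i)) with hcase | hcase
        · -- then min = π and ang(oprod) ≤ π ≤ sum
          rw [min_eq_left hcase] at ih
          linarith
        · rw [min_eq_right hcase] at ih
          linarith

/-- If the ordered product is `-1`, the angles sum to at least `π`. -/
theorem pi_le_sum_ang (V : ℕ → Matrix.specialUnitaryGroup (Fin 2) ℂ) (k : ℕ)
    (h : ((oprod V k : Matrix.specialUnitaryGroup (Fin 2) ℂ) : Matrix (Fin 2) (Fin 2) ℂ) = -1) :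
    π ≤ ∑ i ∈ Finset.range k, ang (V i) := by
  have hang : ang (oprod V k) = π := by
    simp [ang, h, Real.arccos_neg_one]
  have := ang_oprod_le V k
  rw [hang] at this
  by_contra hlt
  rw [not_le] at hlt
  rw [min_eq_right hlt.le] at this
  linarith


/-- Jensen step: `L ≥ 5` angles in `[0, π]` summing to at least `π` have `Σ cos θ_i ≤ L cos(π/L)`. -/
theorem sum_cos_le (L : ℕ) (hL : 5 ≤ L) (θ : ℕ → ℝ) (h0 : ∀ i, 0 ≤ θ i) (hπ : ∀ i, θ i ≤ π)
    (hsum : π ≤ ∑ i ∈ Finset.range L, θ i) :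
    ∑ i ∈ Finset.range L, Real.cos (θ i) ≤ L * Real.cos (π / L) := by
  have hL0 : (0 : ℝ) < L := by exact_mod_cast (show 0 < L by omega)
  have hL5 : (5 : ℝ) ≤ L := by exact_mod_cast hL
  by_cases hall : ∀ i ∈ Finset.range L, θ i ≤ π / 2
  · have hconc : ConcaveOn ℝ (Set.Icc (-(π / 2)) (π / 2)) Real.cos := strictConcaveOn_cos_Icc.concaveOn
    have hw : ∑ _i ∈ Finset.range L, (1 : ℝ) / L = 1 := by
      rw [Finset.sum_const, Finset.card_range, nsmul_eq_mul]; field_simp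
    have hJ := hconc.le_map_sum (t := Finset.range L) (w := fun _ => (1 : ℝ) / L) (p := θ)
      (fun i _ => by positivity) hw
      (fun i hi => ⟨by linarith [h0 i, Real.pi_pos], hall i hi⟩)
    simp only [smul_eq_mul] at hJ
    rw [← Finset.mul_sum, ← Finset.mul_sum] at hJ
    have hmean_ge : π / L ≤ 1 / L * ∑ i ∈ Finset.range L, θ i := by
      rw [div_eq_mul_one_div, mul_comm]
      exact mul_le_mul_of_nonneg_left hsum (by positivity)
    have hsumle : ∑ i ∈ Finset.range L, θ i ≤ L * (π / 2) := by
      calc ∑ i ∈ Finset.range L, θ i ≤ ∑ _i ∈ Finset.range L, π / 2 := Finset.sum_le_sum hall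
        _ = L * (π / 2) := by rw [Finset.sum_const, Finset.card_range, nsmul_eq_mul]
    have hmean_le : 1 / L * ∑ i ∈ Finset.range L, θ i ≤ π / 2 := by
      rw [one_div, inv_mul_le_iff₀ hL0]; exact hsumle
    have hcos : Real.cos (1 / L * ∑ i ∈ Finset.range L, θ i) ≤ Real.cos (π / L) :=
      Real.cos_le_cos_of_nonneg_of_le_pi (by positivity) (hmean_le.trans (by linarith [Real.pi_pos]))
        hmean_ge
    have : 1 / L * ∑ i ∈ Finset.range L, Real.cos (θ i) ≤ Real.cos (π / L) := hJ.trans hcos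
    rwa [one_div, inv_mul_le_iff₀ hL0] at this
  · push Not at hall
    obtain ⟨k, hk, hkgt⟩ := hall
    have hcosk : Real.cos (θ k) < 0 :=
      Real.cos_neg_of_pi_div_two_lt_of_lt hkgt (by linarith [hπ k, Real.pi_pos])
    have h1 : ∑ i ∈ Finset.range L, Real.cos (θ i) ≤ Real.cos (θ k) + ((L : ℝ) - 1) := by
      rw [← Finset.add_sum_erase _ _ hk]
      refine add_le_add le_rfl ?_
      calc ∑ i ∈ (Finset.range L).erase k, Real.cos (θ i)
          ≤ ∑ _i ∈ (Finset.range L).erase k, (1 : ℝ) := Finset.sum_le_sum fun i _ => Real.cos_le_one _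
        _ = ((L : ℝ) - 1) := by
          rw [Finset.sum_const, Finset.card_erase_of_mem hk, Finset.card_range, nsmul_eq_mul, mul_one]
          push_cast [Nat.one_le_iff_ne_zero.mpr (by omega : L ≠ 0)]
          ring
    have h2 : (L : ℝ) - 1 ≤ L * Real.cos (π / L) := by
      have hc := Real.one_sub_sq_div_two_le_cos (x := π / L)
      have hpi : π < 3.15 := Real.pi_lt_d2
      have hx : (π / L) ^ 2 / 2 ≤ 1 / L := by
        rw [div_pow, div_div, div_le_div_iff₀ (by positivity) hL0]
        have hpi2 : π ^ 2 < 10 := by nlinarith [Real.pi_pos]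
        nlinarith
      calc (L : ℝ) - 1 = L * (1 - 1 / L) := by field_simp
        _ ≤ L * (1 - (π / L) ^ 2 / 2) := by gcongr
        _ ≤ L * Real.cos (π / L) := by gcongr
    linarith

end

end Summit.QuantumFields.YangMills.Theorems.CovarianceBound.Negative
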